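import Summits.BirchSwinnertonDyer.BirchSwinnertonDyer.Theses.QuadraticBranchSignedControl
import Summits.BirchSwinnertonDyer.BirchSwinnertonDyer.Theorems.QuadraticBranchSignedControlThm74OfColemanPoitouTateFact
import Summits.BirchSwinnertonDyer.BirchSwinnertonDyer.Theorems.QuadraticBranchSignedControlPlusLowerInclusionUnitRows
import Summits.BirchSwinnertonDyer.BirchSwinnertonDyer.Theorems.QuadraticBranchSignedControlEtaDescentFrame
import Summits.BirchSwinnertonDyer.Rank1Residual.Additive.QuadraticBranchPlusLFunctionUnique
import Literature.NumberTheory.EllipticCurves.Kobayashi2003.EtaColemanPoitouTateZetaSequences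
import Literature.NumberTheory.EllipticCurves.Kato2004.EulerSystemBoundFineSelmer
import Literature.NumberTheory.EllipticCurves.Kato2004.Condition1252QuadraticTwistProofs
import Literature.NumberTheory.EllipticCurves.Kim2025.FineOneSidedDivisibility
import Literature.NumberTheory.EllipticCurves.IwasawaAlgebraDivisibilityProofs
import Literature.NumberTheory.EllipticCurves.IrreducibleModPQuadraticTwistProofs
import Literature.NumberTheory.EllipticCurves.NonEisensteinPrimeOfSurjective
import Literature.NumberTheory.EllipticCurves.Kato2004.IwasawaH1ProjZeroKernelProofs
import Literature.NumberTheory.EllipticCurves.TateModuleFreeProofs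
import HarnessLib

/-!
# K8 crux 20445 `PlusKatoDivisibilityBranchOnto` BY NAME from its three named Literature inputs (rev-23-proof imports)

Cell `bsd-potss` (HOME `run/shared/lean/pub/bsd-potss/`), seat `bsd-potss-k8q-c2x` g4 (prover; lane B of the K8
Kato side, route `QuadraticBranchSignedControl`). HONEST FRAMING: the programme assembles BSD for analytic rank
`≤ 1` strictly from published theorems and types the remainder; BSD is not proved by any of this; the public
theorem is CONDITIONAL on three named Literature facts displayed as hypotheses — `hZ` =
`Kobayashi2003.thm62_63_73_etaColemanPoitouTate_zeta` (Kobayashi Thm. 6.2/6.3/7.3 i)/Cor. 7.2 at `η`, `z` a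
genuine Euler-system class), `h134` = `Kato2004.thm13_4_lengthAt_fineSelmerDual_le_of_isEulerSystemClass` (Kato
Thm. 13.4, reduction-free), `h12` = `Kobayashi2003.thm12_signedSelmerDual_finite_torsion` (Thm. 1.2); the crux is
settled-by-citation (split into three held aliases of exactly these facts); nothing is closed or booked.

## What and why

Route rev 23 (planner g23, 2026-08-27) replaced the all-rows item 19241 by the crux 20445 (tower-onto rows —
exactly where `closes` consumes the Kato half) and named g2's `EulerSystemBound.plusKatoDivisibilityBranch_onto`
(p540932) as kernel glue; dropping the decl `PlusKatoDivisibilityBranch` left that module RED BY IMPORT (its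
chain `…OfEulerSystemBound ← …OfKatoColemanEta ← …OfKatoColeman ← …PlusEtaFramesDischarged` carries theorems whose
TYPES mention the dropped decl). THIS FILE gives the route a glue / closer term independent of that chain: the
PUBLIC theorem `KatoSideOnto.plusKatoDivisibilityBranchOnto_of_zeta_of_thm13_4_of_thm12 : hZ → h134 → h12 →
PlusKatoDivisibilityBranchOnto` (the ROUTE DECL literally) over PRIVATE copies of g0/g2's kernel steps (seat
k8q-c2x, p528359/p539357/p540932; the gate's dedup rule forbids re-landing them publicly while the old modules
are registered): `z ≠ 0` (Rohrlich), `𝐇¹_Γ/Λz` torsion, Kato 13.4 (2)/(3) on the pinned class ((12.5.2) for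
the twist from tower surjectivity of `V`, `√p* ∈ ℚ(ζ_p)`), Kobayashi Thm. 4.1 / 2.2 at `η` row by row along
`0 → 𝐇¹/Λz → Λ/(Col⁺ z) → X(D) → X⁰ → 0` (his printed proof, last sentence of §7), (RK⁺) row by row over the
PROVED frame `etaDescentFrame_proof` and Thm. 1.2. Mathematics unchanged; CM / non-(v) rows not covered.

References: [Kobayashi2003] Thm. 1.2, 2.2, 4.1, 5.2, 6.2, 6.3, Prop. 7.1, Cor. 7.2, Thm. 7.3, proof of Thm.
7.4 and last sentence of §7 (pp. 2–13); [Kato2004Asterisque] (12.5.2) (p. 222), Thm. 13.4 (p. 226);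
[Washington1997] §13.2; [GreenbergLNM1716] §3 (descent; reading).
-/

noncomputable section

-- justification: the `Summit.BirchSwinnertonDyer.BirchSwinnertonDyer.…` path repeats a component (route-file convention)
set_option linter.dupNamespace false

open scoped Classical

open CongruenceSubgroup Field WeierstrassCurve
open Literature.NumberTheory.EllipticCurves
open Literature.NumberTheory.EllipticCurves.ModularForms
open Literature.NumberTheory.EllipticCurves.Module
open Literature.NumberTheory.GaloisRepresentations
open Summit.BirchSwinnertonDyer.Rank1Residual.Additive hiding EtaSignedSelmerDualData
open Summit.BirchSwinnertonDyer.Rank1Residual.Additive.SignedTwist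
open Summit.BirchSwinnertonDyer.BirchSwinnertonDyer.Theses.QuadraticBranchSignedControl

namespace Summit.BirchSwinnertonDyer.BirchSwinnertonDyer.Theorems

namespace KatoSideOnto

section Algebra

variable {p : ℕ} [Fact p.Prime]
  {M : Type} [AddCommGroup M] [_root_.Module (IwasawaAlgebra p) M] [Module.Finite (IwasawaAlgebra p) M]
  {N : Type} [AddCommGroup N] [_root_.Module (IwasawaAlgebra p) N] [Module.Finite (IwasawaAlgebra p) N]

/-- `ℓ_𝔭(N) ≤ ℓ_𝔭(M)` at the height-one primes `𝔭 ∌ p` ⟹ `(pⁿ)·char(M) ⊆ char(N)` for some `n` (g2's lemma,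
private copy). [cite: Washington1997, §13.2] -/
private theorem exists_span_pow_mul_charIdeal_le_of_lengthAt_le (hM : Module.IsTorsion (IwasawaAlgebra p) M)
    (hN : Module.IsTorsion (IwasawaAlgebra p) N)
    (h : ∀ 𝔭 : PrimeSpectrum (IwasawaAlgebra p), 𝔭.asIdeal.height = 1 →
      PowerSeries.C (p : ℤ_[p]) ∉ 𝔭.asIdeal →
        lengthAt (IwasawaAlgebra p) N 𝔭 ≤ lengthAt (IwasawaAlgebra p) M 𝔭) :
    ∃ n : ℕ, Ideal.span {(p : IwasawaAlgebra p) ^ n} * charIdeal (IwasawaAlgebra p) M ≤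
      charIdeal (IwasawaAlgebra p) N := by
  obtain ⟨t, π, ht, -, -, hchar⟩ := SkinnerUrban2014.exists_charIdeal_eq_span_prod (M := M) hM
  set g : IwasawaAlgebra p := ∏ 𝔮 ∈ t, π 𝔮 ^ (lengthAt (IwasawaAlgebra p) M 𝔮).toNat with hg
  have hg0 : g ≠ 0 :=
    Finset.prod_ne_zero_iff.mpr fun 𝔮 h𝔮 ↦ pow_ne_zero _ (ht 𝔮 h𝔮).2.1.ne_zero
  have hby : Module.IsTorsionBy (IwasawaAlgebra p) (IwasawaAlgebra p ⧸ Ideal.span {g}) g :=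
    (Module.isTorsionBy_quotient_iff _ g).mpr fun y ↦ by
      rw [smul_eq_mul]
      exact Ideal.mul_mem_right y _ (Ideal.mem_span_singleton_self g)
  have hQ : Module.IsTorsion (IwasawaAlgebra p) (IwasawaAlgebra p ⧸ Ideal.span {g}) :=
    fun x ↦ ⟨⟨g, mem_nonZeroDivisors_of_ne_zero hg0⟩, @hby x⟩
  have hcharQ : charIdeal (IwasawaAlgebra p) (IwasawaAlgebra p ⧸ Ideal.span {g}) =
      charIdeal (IwasawaAlgebra p) M := by
    rw [charIdeal_eq_span_of_lengthAt_eq_quotient hg0 fun _ _ ↦ rfl, hchar]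
  have hlen : ∀ 𝔭 : PrimeSpectrum (IwasawaAlgebra p), 𝔭.asIdeal.height = 1 →
      PowerSeries.C (p : ℤ_[p]) ∉ 𝔭.asIdeal →
      lengthAt (IwasawaAlgebra p) N 𝔭 ≤
        lengthAt (IwasawaAlgebra p) (IwasawaAlgebra p ⧸ Ideal.span {g}) 𝔭 := fun 𝔭 h𝔭 hp𝔭 ↦ by
    rw [SkinnerUrban2014.lengthAt_eq_of_charIdeal_eq hQ hM hcharQ 𝔭 h𝔭]
    exact h 𝔭 h𝔭 hp𝔭
  obtain ⟨m, hm⟩ :=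
    exists_pow_mul_mem_charIdeal_of_lengthAt_le hN (IwasawaAlgebra.prime_C p) hg0 hlen
  refine ⟨m, ?_⟩
  rw [hchar, Ideal.span_singleton_mul_span_singleton, Ideal.span_singleton_le_iff_mem]
  have hp' : ((p : ℕ) : IwasawaAlgebra p) = PowerSeries.C (p : ℤ_[p]) := by rw [map_natCast]
  rw [hp']
  exact hm

variable {R : Type} [CommRing R] [IsNoetherianRing R] [IsDomain R] [UniqueFactorizationMonoid R]
variable {A X B : Type} [AddCommGroup A] [_root_.Module R A] [AddCommGroup X] [_root_.Module R X]
  [AddCommGroup B] [_root_.Module R B]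

/-- `J·char(A) ⊆ char(B) ⟹ J·(L) ⊆ char(X)` along an exact `0 → A → R/(L) → X → B → 0` (g0's lemma, private
copy). [cite: Kobayashi2003, proof of Thm. 7.4 and last sentence of §7 (p. 13)] -/
private theorem mul_span_singleton_le_charIdeal_of_fourTermExact [Module.Finite R B]
    (hB : Module.IsTorsion R B) {L : R} (hL : L ≠ 0)
    (f : A →ₗ[R] R ⧸ Ideal.span {L}) (g : (R ⧸ Ideal.span {L}) →ₗ[R] X) (h : X →ₗ[R] B)
    (hf : Function.Injective f) (hfg : Function.Exact f g) (hgh : Function.Exact g h)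
    (hh : Function.Surjective h) (J : Ideal R)
    (hAB : J * Module.charIdeal R A ≤ Module.charIdeal R B) :
    J * Ideal.span {L} ≤ Module.charIdeal R X := by
  obtain ⟨q, e1, e2⟩ :=
    Thm74Skeleton.exists_charIdeal_factor_of_fourTermExact hB hL f g h hf hfg hgh hh
  calc J * Ideal.span {L} = J * Module.charIdeal R A * q := by rw [e1, mul_assoc]
    _ ≤ Module.charIdeal R B * q := Ideal.mul_mono_left hAB
    _ = Module.charIdeal R X := by rw [e2, mul_comm]

end Algebra

section Row

variable {p : ℕ} [Fact p.Prime] {K₀ : Type} [Field K₀] [NumberField K₀]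
  [(galRange (K := ℚ) K₀).Normal] {η : absoluteGaloisGroup ℚ →* ℤˣ}
  {V : WeierstrassCurve ℚ} [V.IsElliptic] [V.IsGloballyMinimal] {N : ℕ} [NeZero N]
  {f : CuspForm (Gamma0 N) 2} {ϖ : ℚ} {κ : ZpExtension ℚ p} {γ : absoluteGaloisGroup ℚ}
  {W : WeierstrassCurve ℚ} [W.IsElliptic] [ContinuousSMul ℤ_[p] (W.tateModule p)]
  [Module.Free ℤ_[p] (W.tateModule p)] [Module.Finite ℤ_[p] (W.tateModule p)]
  {I : Kato2004.IwasawaH1Data W p κ γ} {FB : W.FineSelmerDualData κ γ}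

/-- `Col⁺(z) ≠ 0` on a genuine frame: `Col⁺(z) = L_p⁺(V, η, X) ≠ 0` (Rohrlich; periods positive).
[cite: Kobayashi2003, Thm. 6.3 (p. 11) and Thm. 7.3 i) (p. 13)] -/
private theorem colPlus_z_ne_zero (E : Kobayashi2003.EtaColemanPoitouTateZetaData p K₀ η V f ϖ κ γ W I FB)
    (hp2 : p ≠ 2) (hgood : V.HasGoodReductionAtPrime p) (hf : IsNewformOf V f)
    (hϖ : if Even (p / 2) then (ϖ : ℝ) * V.realPeriodRat = plusPeriod f
      else (ϖ : ℝ) * V.imaginaryPeriodRat = minusPeriod f) : E.colPlus E.z ≠ 0 := by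
  have hϖ0 : ϖ ≠ 0 := by
    rintro rfl
    rw [Rat.cast_zero, zero_mul, zero_mul] at hϖ
    by_cases h2 : Even (p / 2)
    · rw [if_pos h2] at hϖ
      exact (IsNewform0.plusPeriod_pos_holds hf.1 hf.coeffField_eq_bot).ne hϖ
    · rw [if_neg h2] at hϖ
      exact (IsNewform0.minusPeriod_pos_holds hf.1 hf.coeffField_eq_bot).ne hϖ
  exact IsQuadraticBranchPlusLFunction.ne_zero_of_isNewformOf hp2 hf hgood hϖ0 E.isPlus_colPlus_z

/-- `z ≠ 0` and `𝐇¹_Γ(T_pW)/Λz` is torsion on a genuine frame (killed by `Col⁺(z) ≠ 0`, `Col⁺ ∘ loc` injective).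
[cite: Kobayashi2003, Thm. 7.3 i) (p. 13)] -/
private theorem z_ne_zero_and_isTorsion_quotient
    (E : Kobayashi2003.EtaColemanPoitouTateZetaData p K₀ η V f ϖ κ γ W I FB)
    (hp2 : p ≠ 2) (hgood : V.HasGoodReductionAtPrime p) (hf : IsNewformOf V f)
    (hϖ : if Even (p / 2) then (ϖ : ℝ) * V.realPeriodRat = plusPeriod f
      else (ϖ : ℝ) * V.imaginaryPeriodRat = minusPeriod f) :
    E.z ≠ 0 ∧ Module.IsTorsion (IwasawaAlgebra p) (I.H ⧸ Submodule.span (IwasawaAlgebra p) {E.z}) := by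
  have hL0 := colPlus_z_ne_zero E hp2 hgood hf hϖ
  refine ⟨fun hz => hL0 (by rw [hz, map_zero]), ?_⟩
  intro x
  refine ⟨⟨E.colPlus E.z, mem_nonZeroDivisors_of_ne_zero hL0⟩, ?_⟩
  induction x using Submodule.Quotient.induction_on with
  | H m =>
    rw [Submonoid.mk_smul, ← Submodule.Quotient.mk_smul, Submodule.Quotient.mk_eq_zero,
      Submodule.mem_span_singleton]
    refine ⟨E.colPlus m, E.colPlus_injective ?_⟩
    rw [map_smul, map_smul, smul_eq_mul, smul_eq_mul, mul_comm]

/-- **Kato 13.4 (2)/(3) on the pinned class** (`(pⁿ)·Char(𝐇¹_Γ/Λz) ⊆ Char X₀` under (v) for `W`; integrally when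
`ρ̄_{V,p^m}` is onto for all `m`, via (12.5.2) for the twist); private copy of g2's `kato_rational/integral_of_zeta`.
[cite: Kato2004Asterisque, Thm. 13.4 (2)(3) (p. 226), (12.5.2) (p. 222)] -/
private theorem kato_bounds_of_zeta
    (E : Kobayashi2003.EtaColemanPoitouTateZetaData p K₀ η V f ϖ κ γ W I FB)
    (h134 : Kato2004.thm13_4_lengthAt_fineSelmerDual_le_of_isEulerSystemClass)
    (hp2 : p ≠ 2) (hgood : V.HasGoodReductionAtPrime p) (hf : IsNewformOf V f)
    (hϖ : if Even (p / 2) then (ϖ : ℝ) * V.realPeriodRat = plusPeriod f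
      else (ϖ : ℝ) * V.imaginaryPeriodRat = minusPeriod f)
    (hκ : κ.IsCyclotomic) (hγ : κ.IsTopGenerator γ) (C : VariableChange ℚ)
    (hWV : C • W.quadraticTwist (((-1 : ℚ) ^ (p / 2)) * p) = V)
    (hv : ∃ σ : absoluteGaloisGroup ℚ,
      (∀ (n : ℕ) (t : AlgebraicClosure ℚ), t ^ p ^ n = 1 → σ • t = t) ∧
        Module.finrank ℤ_[p]
          ((W.tateModule p) ⧸ LinearMap.range (W.galoisRepTate p σ - 1)) = 1) :
    (∃ n : ℕ, Ideal.span {(p : IwasawaAlgebra p) ^ n} *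
        Module.charIdeal (IwasawaAlgebra p) (I.H ⧸ Submodule.span (IwasawaAlgebra p) {E.z}) ≤
      Module.charIdeal (IwasawaAlgebra p) FB.X) ∧
    ((∀ m : ℕ, V.HasSurjectiveModNGaloisRep (p ^ m : ℕ)) →
      Module.charIdeal (IwasawaAlgebra p) (I.H ⧸ Submodule.span (IwasawaAlgebra p) {E.z}) ≤
        Module.charIdeal (IwasawaAlgebra p) FB.X) := by
  have hp : p.Prime := Fact.out
  haveI : Module.Finite (IwasawaAlgebra p) I.H :=
    Kato2004.IwasawaH1Data.module_finite_of_isCyclotomic hκ hγ I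
  haveI : Module.Finite (IwasawaAlgebra p) FB.X :=
    WeierstrassCurve.FineSelmerDualData.module_finite _ κ hγ FB
  obtain ⟨hz0, htor⟩ := z_ne_zero_and_isTorsion_quotient E hp2 hgood hf hϖ
  refine ⟨?_, fun hsurj => ?_⟩
  · obtain ⟨h2, -⟩ := h134 W p κ γ hp2 hκ hγ I FB E.z E.isEulerSystemClass_z hz0 hv
    exact exists_span_pow_mul_charIdeal_le_of_lengthAt_le htor E.isTorsion_fine h2
  · haveI : NeZero ((p : ℕ) : ℚ) := ⟨Nat.cast_ne_zero.mpr hp.ne_zero⟩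
    have hirrV : V.HasIrreducibleModPGaloisRep p :=
      hasIrreducibleModPGaloisRep_of_hasSurjectiveModNGaloisRep V p (by simpa using hsurj 1)
    have hc : (((-1 : ℚ) ^ (p / 2)) * p) ≠ 0 :=
      mul_ne_zero (pow_ne_zero _ (by norm_num)) (Nat.cast_ne_zero.mpr hp.ne_zero)
    have hirrW : W.HasIrreducibleModPGaloisRep p := by
      have h1 := Mazur1978.hasIrreducibleModPGaloisRep_smul_iff
        (W.quadraticTwist (((-1 : ℚ) ^ (p / 2)) * p)) C p
      rw [hWV] at h1
      exact (W.hasIrreducibleModPGaloisRep_quadraticTwist_iff hc p).mp (h1.mp hirrV)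
    have h3W :=
      Kato2004.exists_coker_free_of_smul_eq_quadraticTwist_primeStar_of_forall_hasSurjectiveModNGaloisRep
        hp2 C hWV hsurj
    have hvW :=
      Kato2004.exists_finrank_coker_eq_one_of_smul_eq_quadraticTwist_primeStar_of_forall_hasSurjectiveModNGaloisRep
        hp2 C hWV hsurj
    obtain ⟨-, h3⟩ := h134 W p κ γ hp2 hκ hγ I FB E.z E.isEulerSystemClass_z hz0 hvW
    exact Kim2025.charIdeal_le_charIdeal_of_lengthAt_le htor E.isTorsion_fine (h3 hirrW h3W)

end Row

section RK

variable {p : ℕ} [Fact p.Prime]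

/-- **Kobayashi Thm. 2.2 (`+`) and Thm. 4.1 at the quadratic `η` for ONE curve from `{hZ, h134}`** under the ROW
hypothesis (v) for `V^{(p*)}` (his printed proof, last sentence of §7); private copy of g2's §3.
[cite: Kobayashi2003, Thm. 2.2 (p. 5), Thm. 4.1 (p. 8), proof of Thm. 7.4 (p. 13)] [cite: Kato2004Asterisque, Thm. 13.4 (p. 226)] -/
private theorem etaKatoDivisibility_of_zeta_of_thm13_4
    (hZ : Kobayashi2003.thm62_63_73_etaColemanPoitouTate_zeta)
    (h134 : Kato2004.thm13_4_lengthAt_fineSelmerDual_le_of_isEulerSystemClass)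
    (K₀ : Type) [Field K₀] [NumberField K₀] [IsCyclotomicExtension {p} ℚ K₀]
    [(galRange (K := ℚ) K₀).Normal] (ηq : absoluteGaloisGroup ℚ →* ℤˣ)
    (hηK : ∀ σ ∈ galRange (K := ℚ) K₀, ηq σ = 1) (hη1 : ηq ≠ 1)
    (V : WeierstrassCurve ℚ) [V.IsElliptic] [V.IsGloballyMinimal]
    (hv : ∀ [(V.quadraticTwist (((-1 : ℚ) ^ (p / 2)) * p)).IsElliptic],
      ∃ σ : absoluteGaloisGroup ℚ,
        (∀ (n : ℕ) (t : AlgebraicClosure ℚ), t ^ p ^ n = 1 → σ • t = t) ∧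
          Module.finrank ℤ_[p]
            (((V.quadraticTwist (((-1 : ℚ) ^ (p / 2)) * p)).tateModule p) ⧸
              LinearMap.range
                ((V.quadraticTwist (((-1 : ℚ) ^ (p / 2)) * p)).galoisRepTate p σ - 1)) = 1)
    {N : ℕ} [NeZero N] {f : CuspForm (Gamma0 N) 2} (hp2 : p ≠ 2)
    (hgood : V.HasGoodReductionAtPrime p) (hap : V.frobeniusTrace p = 0) (hf : IsNewformOf V f)
    (ϖ : ℚ) (hϖ : if Even (p / 2) then (ϖ : ℝ) * V.realPeriodRat = plusPeriod f
      else (ϖ : ℝ) * V.imaginaryPeriodRat = minusPeriod f)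
    (Lη : IwasawaAlgebra p) (hL : IsQuadraticBranchPlusLFunction f p ϖ Lη)
    (κ : ZpExtension ℚ p) (γ : absoluteGaloisGroup ℚ) (hκ : κ.IsCyclotomic) (hγ : κ.IsTopGenerator γ)
    (hγK : γ ∈ galRange (K := ℚ) K₀) (hγc : IsCyclotomicVariable p γ)
    (D : Kobayashi2003.EtaSignedSelmerDualData V κ K₀ ℚ_[p] ηq γ 1) :
    Module.Finite (IwasawaAlgebra p) D.X ∧ Module.IsTorsion (IwasawaAlgebra p) D.X ∧
      (∃ n : ℕ, (p : IwasawaAlgebra p) ^ n * Lη ∈ D.charIdeal) ∧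
      ((∀ m : ℕ, V.HasSurjectiveModNGaloisRep (p ^ m : ℕ)) → Lη ∈ D.charIdeal) := by
  have hc : (((-1 : ℚ) ^ (p / 2)) * p) ≠ 0 :=
    mul_ne_zero (pow_ne_zero _ (by norm_num)) (Nat.cast_ne_zero.mpr (Fact.out : p.Prime).ne_zero)
  haveI : (V.quadraticTwist (((-1 : ℚ) ^ (p / 2)) * p)).IsElliptic := V.isElliptic_quadraticTwist hc
  haveI : ContinuousSMul ℤ_[p] ((V.quadraticTwist (((-1 : ℚ) ^ (p / 2)) * p)).tateModule p) :=
    TateModule.continuousSMul_padicInt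
  haveI : Module.Free ℤ_[p] ((V.quadraticTwist (((-1 : ℚ) ^ (p / 2)) * p)).tateModule p) :=
    (V.quadraticTwist (((-1 : ℚ) ^ (p / 2)) * p)).module_free_tateModule_holds p
  haveI : Module.Finite ℤ_[p] ((V.quadraticTwist (((-1 : ℚ) ^ (p / 2)) * p)).tateModule p) :=
    (V.quadraticTwist (((-1 : ℚ) ^ (p / 2)) * p)).module_finite_tateModule_holds p
  obtain ⟨C, hC⟩ := exists_variableChange_twist_twist V hc
  obtain ⟨I⟩ := Kato2004.nonempty_iwasawaH1Data_holds (V.quadraticTwist (((-1 : ℚ) ^ (p / 2)) * p))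
    p κ γ hκ hγ
  obtain ⟨FB⟩ := (V.quadraticTwist (((-1 : ℚ) ^ (p / 2)) * p)).nonempty_fineSelmerDualData κ hγ
  haveI : Module.Finite (IwasawaAlgebra p) FB.X :=
    WeierstrassCurve.FineSelmerDualData.module_finite _ κ hγ FB
  obtain ⟨E⟩ := hZ p K₀ ηq hηK hη1 V hp2 hgood hap hf ϖ hϖ κ γ hκ hγ hγK hγc
    (V.quadraticTwist (((-1 : ℚ) ^ (p / 2)) * p)) C hC I FB
  obtain ⟨⟨n, hn⟩, hint⟩ := kato_bounds_of_zeta E h134 hp2 hgood hf hϖ hκ hγ C hC hv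
  obtain ⟨j, k, hcj, hjk, hk⟩ := E.exact_plus D
  obtain ⟨i, j', k', hi, hij, hjk', hk'⟩ :=
    Thm74Skeleton.exists_fourTermExact_of_threeTermExact E.colPlus j k E.colPlus_injective hcj hjk hk
      E.z
  have hL0 : E.colPlus E.z ≠ 0 := colPlus_z_ne_zero E hp2 hgood hf hϖ
  have hspan : Ideal.span ({Lη} : Set (IwasawaAlgebra p)) = Ideal.span {E.colPlus E.z} :=
    IsQuadraticBranchPlusLFunction.span_singleton_eq hp2 hL E.isPlus_colPlus_z
  refine ⟨Module.Finite.of_exact hjk hk,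
    Thm74Skeleton.isTorsion_of_exact (Thm74Skeleton.isTorsion_quotient_span_singleton hL0)
      E.isTorsion_fine j' k' hjk', ⟨n, ?_⟩, fun hsurj => ?_⟩
  · have hle := mul_span_singleton_le_charIdeal_of_fourTermExact E.isTorsion_fine hL0
      i j' k' hi hij hjk' hk' _ hn
    rw [← hspan, Ideal.span_singleton_mul_span_singleton, Ideal.span_singleton_le_iff_mem] at hle
    exact hle
  · have hle := Thm74Skeleton.span_singleton_le_charIdeal_of_fourTermExact E.isTorsion_fine hL0
      i j' k' hi hij hjk' hk' (hint hsurj)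
    rw [← hspan, Ideal.span_singleton_le_iff_mem] at hle
    exact hle

/-- **(RK⁺) for ONE tower-onto curve from `{hZ, h134, h12}` + the proved descent frame** ((v) for `V^{(p*)}` is
automatic there: `√p* ∈ ℚ(ζ_p)`); private copy of g2's §4. [cite: Kobayashi2003, Thm. 1.2 (p. 2), Thm. 4.1 (p. 8)]
[cite: Kato2004Asterisque, (12.5.2) (p. 222), Thm. 13.4 (p. 226)] [cite: GreenbergLNM1716, §3 (descent; reading)] -/
private theorem quadraticBranchPlusKatoDivisibilityAt_of_facts_of_onto
    (hZ : Kobayashi2003.thm62_63_73_etaColemanPoitouTate_zeta)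
    (h134 : Kato2004.thm13_4_lengthAt_fineSelmerDual_le_of_isEulerSystemClass)
    (h12 : Kobayashi2003.thm12_signedSelmerDual_finite_torsion)
    (V : WeierstrassCurve ℚ) [V.IsElliptic] [V.IsGloballyMinimal] (hp5 : 5 ≤ p)
    (hgood : V.HasGoodReductionAtPrime p) (hap : V.frobeniusTrace p = 0)
    (hsurj : ∀ m : ℕ, V.HasSurjectiveModNGaloisRep (p ^ m : ℕ)) :
    QuadraticBranchPlusKatoDivisibilityAt V p := by
  have hp2 : p ≠ 2 := by omega
  have hc : (((-1 : ℚ) ^ (p / 2)) * p) ≠ 0 :=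
    mul_ne_zero (pow_ne_zero _ (by norm_num)) (Nat.cast_ne_zero.mpr (Fact.out : p.Prime).ne_zero)
  have hv : ∀ [(V.quadraticTwist (((-1 : ℚ) ^ (p / 2)) * p)).IsElliptic],
      ∃ σ : absoluteGaloisGroup ℚ,
        (∀ (n : ℕ) (t : AlgebraicClosure ℚ), t ^ p ^ n = 1 → σ • t = t) ∧
          Module.finrank ℤ_[p]
            (((V.quadraticTwist (((-1 : ℚ) ^ (p / 2)) * p)).tateModule p) ⧸
              LinearMap.range
                ((V.quadraticTwist (((-1 : ℚ) ^ (p / 2)) * p)).galoisRepTate p σ - 1)) = 1 := by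
    intro _
    obtain ⟨C, hC⟩ := exists_variableChange_twist_twist V hc
    exact Kato2004.exists_finrank_coker_eq_one_of_smul_eq_quadraticTwist_primeStar_of_forall_hasSurjectiveModNGaloisRep
      hp2 C hC hsurj
  haveI : NeZero p := ⟨(Fact.out : p.Prime).ne_zero⟩
  haveI : IsCyclotomicExtension {p} ℚ (CyclotomicField p ℚ) :=
    CyclotomicField.isCyclotomicExtension p ℚ
  haveI : (galRange (K := ℚ) (CyclotomicField p ℚ)).Normal := normal_galRange_cyclotomic p _
  obtain ⟨θ, ηq, -, -, -, hηK, hη1⟩ := exists_theta_eta_cyclotomicField p hp2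
  intro F _ _ V' _ κ γ κF γF N _ f hp2' hgood' hap' hF hθ hC hκ hγ hγc hκF hγF hζ hf ϖ hϖ Lη hL D DF
  obtain ⟨γ', hγ'K, hγ', hγ'c, Dη, ⟨e⟩⟩ :=
    exists_etaDatum_prod_linearEquiv_of_decomposition (CyclotomicField p ℚ) ηq
      (fun κ₁ γ₁ hκ₁ hγ₁ hγ₁K hγ₁c F₁ _ _ V₁ _ κF₁ γF₁ hF₁ hθ₁ hC₁ hκF₁ hγF₁ hζ₁ =>
        etaDescentFrame_proof p hp5 (CyclotomicField p ℚ) ηq hηK hη1 V hgood hap κ₁ γ₁ hκ₁ hγ₁ hγ₁K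
          hγ₁c F₁ V₁ κF₁ γF₁ hF₁ hθ₁ hC₁ hκF₁ hγF₁ hζ₁)
      F V' hF hθ hC hκ hγ hγc hκF hγF hζ D DF
  obtain ⟨hDfin, hDtor⟩ := h12 V p hp2 hgood hap κ γ hκ hγ 1 D
  -- Thm. 2.2 and Thm. 4.1 at `η` for `Dη`, through the Literature promotion copy of the `η`-object
  let Dη' : Kobayashi2003.EtaSignedSelmerDualData V κ (CyclotomicField p ℚ) ℚ_[p] ηq γ' 1 :=
    { X := Dη.X
      conj_mem := Dη.conj_mem
      toDual := Dη.toDual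
      bijective := Dη.bijective
      toDual_T_smul := Dη.toDual_T_smul
      toDual_C_smul := Dη.toDual_C_smul }
  obtain ⟨hηfin, hηtor, ⟨n, hn⟩, hint⟩ :=
    etaKatoDivisibility_of_zeta_of_thm13_4 hZ h134 (CyclotomicField p ℚ) ηq hηK hη1 V hv hp2 hgood
      hap hf ϖ hϖ Lη hL κ γ' hκ hγ' hγ'K hγ'c Dη'
  haveI : Module.Finite (IwasawaAlgebra p) D.X := hDfin
  haveI : Module.Finite (IwasawaAlgebra p) Dη.X := hηfin
  have hPtor : Module.IsTorsion (IwasawaAlgebra p) (D.X × Dη.X) :=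
    isTorsion_prod_of_isTorsion hDtor hηtor
  have hPchar : Module.charIdeal (IwasawaAlgebra p) (D.X × Dη.X) =
      Module.charIdeal (IwasawaAlgebra p) D.X * Module.charIdeal (IwasawaAlgebra p) Dη.X :=
    charIdeal_mul_of_shortExact_holds p (D.X × Dη.X) hPtor
      (LinearMap.inl (IwasawaAlgebra p) D.X Dη.X) (LinearMap.snd (IwasawaAlgebra p) D.X Dη.X)
      LinearMap.inl_injective LinearMap.snd_surjective .inl_snd
  have htorF : Module.IsTorsion (IwasawaAlgebra p) DF.X := by
    intro x
    obtain ⟨a, ha⟩ := @hPtor (e x)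
    refine ⟨a, ?_⟩
    rw [Submonoid.smul_def] at ha ⊢
    have h := congrArg e.symm ha
    rwa [map_smul, map_zero, LinearEquiv.symm_apply_apply] at h
  have hcharF : DF.charIdeal = D.charIdeal * Dη.charIdeal := by
    change Module.charIdeal (IwasawaAlgebra p) DF.X =
      Module.charIdeal (IwasawaAlgebra p) D.X * Module.charIdeal (IwasawaAlgebra p) Dη.X
    rw [Module.charIdeal_eq_of_linearEquiv e]
    exact hPchar
  refine ⟨Module.Finite.equiv e.symm, htorF, ⟨n, ?_⟩, fun hsurj' => ?_⟩
  · rw [hcharF, mul_left_comm, Ideal.span_singleton_mul_span_singleton]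
    exact Ideal.mul_mono_right ((Ideal.span_singleton_le_iff_mem _).mpr hn)
  · rw [hcharF]
    exact Ideal.mul_mono_right ((Ideal.span_singleton_le_iff_mem _).mpr (hint hsurj'))

end RK

/-- **Crux 20445 `PlusKatoDivisibilityBranchOnto` BY NAME, from three named Literature facts** — `hZ`
(Kobayashi Thm. 6.2/6.3/7.3 i)/Cor. 7.2 at `η` with `z` a genuine Euler-system class), `h134` (Kato Thm. 13.4,
reduction-free), `h12` (Kobayashi Thm. 1.2) — and the PROVED frame `etaDescentFrame_proof`: for every globally
minimal `V/ℚ`, `p ≥ 5` good with `a_p = 0` and `ρ̄_{V,p^m}` onto for all `m`,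
`QuadraticBranchPlusKatoDivisibilityAt V p`; the conclusion is the ROUTE DECL (the type the gate compares with the
item). CONDITIONAL — exactly the three held children of the planner's split (Kobayashi zeta-eta package, Kato
13.4, Kobayashi 1.2); as the children are by-name aliases of these facts, this term is also the split's glue, and
its import closure avoids every module reddened by rev 23. Same mathematics as g2's
`EulerSystemBound.plusKatoDivisibilityBranch_onto` (p540932).
[cite: Kobayashi2003, Thm. 4.1 (p. 8), Thm. 2.2 (p. 5), Thm. 1.2 (p. 2), last sentence of §7 (p. 13)]
[cite: Kato2004Asterisque, Thm. 13.4 (p. 226), (12.5.2) (p. 222)] -/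
theorem plusKatoDivisibilityBranchOnto_of_zeta_of_thm13_4_of_thm12
    (hZ : Kobayashi2003.thm62_63_73_etaColemanPoitouTate_zeta)
    (h134 : Kato2004.thm13_4_lengthAt_fineSelmerDual_le_of_isEulerSystemClass)
    (h12 : Kobayashi2003.thm12_signedSelmerDual_finite_torsion) :
    PlusKatoDivisibilityBranchOnto :=
  fun V _ _ _ _ hp5 hgood hap hsurj =>
    quadraticBranchPlusKatoDivisibilityAt_of_facts_of_onto hZ h134 h12 V hp5 hgood hap hsurj

end KatoSideOnto

end Summit.BirchSwinnertonDyer.BirchSwinnertonDyer.Theorems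

end
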